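import Summits.BirchSwinnertonDyer.BirchSwinnertonDyer.Theorems.ManinLocalTwoThreeManinPrimeToAdditiveFiveLeAcrossIsogenyOfStrongIsUnstarred
import HarnessLib

/-!
# Route `ManinLocalTwoThree`, residual crux C5 `ManinPrimeToAdditiveFiveLe` (stmt-BirchSwinnertonDyer-22969), line
# `upper_anchor`: **E-imc-5 `OptimalUnstarredAcrossIsogeny p` is a THEOREM at every prime `p ≡ 1 (mod 12)`** (e.g. `13`,
# `37`, `61`) — by Coates' congruence a `p`-isogeny then PRESERVES `ord_p Δ_min` at a potentially good additive `p`

Width seat bsd-line-ml23-c5-p1-w2 (gen 5), piece ψ4 (sequel of `…AcrossIsogenyOfStrongIsUnstarred.lean`). The imc planner's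
`@[conjecture]` E-imc-5 (`Summits/…/ManinAdditive/OptimalUnstarredAcrossIsogeny.lean`, all primes `p ≥ 5`; census «78 more
at `p ≥ 11`») says: the lattice-optimal curve is never the starred end of a rational `p`-isogeny facing an unstarred end. For
`p ≡ 1 (mod 12)` there is nothing to prove: along a `ℚ`-isogeny of degree `p` between globally minimal curves Coates'
congruence (`padicValInt_minimalDiscriminantInt_modEq_twelve_of_degree_prime`, from the tree's PROVED Vélu-form lemma) reads
`ord_p Δ_min(W₂) ≡ p · ord_p Δ_min(W) ≡ ord_p Δ_min(W) (mod 12)`, and both valuations lie in Tate's list `{2,…,10}` once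
`W₂` (hence `W`) is potentially good — which `ord_p Δ_min(W₂) < 6` forces. So `ord_p Δ_min(W) = ord_p Δ_min(W₂) < 6`.

* `padicValInt_minimalDiscriminantInt_eq_of_degree_prime_of_mod_twelve` — `ord_p Δ_min(W) = ord_p Δ_min(W₂)` along a
  degree-`p` isogeny, `p ≡ 1 (mod 12)`, `W` additive at `p`, `ord_p Δ_min(W₂) < 6` (no optimality, no lattice).
* `optimalUnstarredAcrossIsogeny_of_mod_twelve_eq_one` — **`OptimalUnstarredAcrossIsogeny p` for every prime `p` with
  `p % 12 = 1`**, UNCONDITIONAL (its lattice clause is idle).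

HONEST STATUS: a theorem about a registered conjecture of the cell at the primes `p ≡ 1 (mod 12)` only; E-imc-5 at
`p ≡ 5, 7, 11 (mod 12)` (in particular at `5` and `7`, the primes of C5) stays OPEN (there the congruence flips the
potentially supersingular rows); nothing here proves C5, Manin's conjecture or BSD.

References: [DokchitserDokchitser2015LocalInvariants] §2 Thm. 3 (Coates), §3 Thm. 6, Cor. 8 («`l ≡ 1 mod 12`: potentially
ordinary, `δ = δ′`»); [SilvermanATAEC1994] IV Table 4.1.
-/

set_option autoImplicit false
-- the Theorems namespace of this sub repeats the summit name by design (D-0017 nested layout)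
set_option linter.dupNamespace false

noncomputable section

open scoped Classical NumberField

namespace Summit.BirchSwinnertonDyer.BirchSwinnertonDyer.Theorems

open WeierstrassCurve IsDedekindDomain IsDedekindDomain.HeightOneSpectrum Rat.HeightOneSpectrum NumberField
  Literature.NumberTheory.EllipticCurves Literature.NumberTheory.EllipticCurves.ModularForms
  Literature.NumberTheory.EllipticCurves.Rank1Residual
  Literature.NumberTheory.DiophantineGeometry
  Summit.BirchSwinnertonDyer.Rank1Residual
  Summit.BirchSwinnertonDyer.Rank1Residual.ManinAdditive
  Summit.BirchSwinnertonDyer.Rank1Residual.Additive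

/-- **`ord_p Δ_min` is preserved by a `ℚ`-isogeny of prime degree `p ≡ 1 (mod 12)` out of an additive fibre, when the
target has `ord_p Δ_min < 6`** (globally minimal models). The target is additive (isogeny invariance) without `Iₙ*`
fibre, hence potentially good, hence so is the source; Coates' congruence `p·δ ≡ δ₂ (mod 12)` with `p ≡ 1` and
`δ, δ₂ ∈ {2,3,4,6,8,9,10}` gives `δ = δ₂`. [cite: DokchitserDokchitser2015LocalInvariants, §3 Thm. 6 and Cor. 8]
[cite: SilvermanATAEC1994, IV Table 4.1] -/
theorem padicValInt_minimalDiscriminantInt_eq_of_degree_prime_of_mod_twelve {p : ℕ} [hpF : Fact p.Prime]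
    (hp12 : p % 12 = 1) (W W₂ : WeierstrassCurve ℚ) [W.IsElliptic] [W.IsGloballyMinimal] [W₂.IsElliptic]
    [W₂.IsGloballyMinimal] (φ : Isogeny W W₂) (hdeg : φ.degree = p) (hadd : Addv W p)
    (hv₂ : padicValInt p W₂.minimalDiscriminantInt < 6) :
    padicValInt p W.minimalDiscriminantInt = padicValInt p W₂.minimalDiscriminantInt := by
  have hp : p.Prime := hpF.out
  have hp5 : 5 ≤ p := by have := hp.two_le; omega
  have hp2 : p ≠ 2 := by omega
  have hiso : IsIsogenous W W₂ := ⟨φ⟩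
  have hadd₂ : Addv W₂ p := (Summit.BirchSwinnertonDyer.Rank1Residual.X2.addv_iff_of_isIsogenous hiso).mp hadd
  -- the target has no `Iₙ*` fibre, so both curves are potentially good at `p`
  have hI₂ : ∀ n : ℕ, W₂.kodairaSymbolAt (placeOf p) ≠ .Istar n := by
    intro n hK
    rcases kodairaSymbolAt_placeOf_cases_of_addv W₂ p hp5 hadd₂ with
      ⟨h, -⟩ | ⟨h, -⟩ | ⟨h, -⟩ | ⟨m, -, hv⟩ | ⟨h, -⟩ | ⟨h, -⟩ | ⟨h, -⟩
    all_goals first | omega | (rw [hK] at h; cases h)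
  have hj₂ : 0 ≤ padicValRat p W₂.j := by
    refine MemberManinUnitFiveSevenGlue.padicValRat_j_nonneg_of_forall_ne_Istar W₂ hp2 hadd₂ ?_
    intro v n hv' hK
    have hvv : v = placeOf p := (primesEquiv (R := ℤ)).injective
      (Subtype.ext (hv'.trans (natGenerator_placeOf_eq p).symm))
    subst hvv
    exact hI₂ n hK
  obtain ⟨-, hj⟩ := Addv.of_isIsogenous_of_padicValRat_j_nonneg (p := p) hadd₂ hj₂ hiso.symm_of_charZero
  have hmem := padicValInt_minimalDiscriminantInt_mem_of_addv_of_padicValRat_j_nonneg W p hp5 hadd hj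
  have hmem₂ := padicValInt_minimalDiscriminantInt_mem_of_addv_of_padicValRat_j_nonneg W₂ p hp5 hadd₂ hj₂
  -- Coates: `p·δ ≡ δ₂ (mod 12)` with `p ≡ 1`
  have hmod := padicValInt_minimalDiscriminantInt_modEq_twelve_of_degree_prime φ hp hp5 hdeg p
  rw [Int.modEq_iff_dvd] at hmod
  obtain ⟨q, rfl⟩ : ∃ q : ℕ, p = 12 * q + 1 := ⟨p / 12, by omega⟩
  push_cast at hmod
  rcases hmem with h | h | h | h | h | h | h <;> rcases hmem₂ with h' | h' | h' | h' | h' | h' | h' <;>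
    rw [h, h'] at hmod ⊢ <;> omega

/-- **E-imc-5 `OptimalUnstarredAcrossIsogeny p` holds at every prime `p ≡ 1 (mod 12)`** — unconditionally, its lattice
clause idle: `ord_p Δ_min` does not move along a degree-`p` isogeny there (previous theorem), so an unstarred target
(`< 6`) has an unstarred source. The conjecture stays OPEN at `p ≡ 5, 7, 11 (mod 12)`, in particular at the primes `5`,
`7` of C5. [cite: DokchitserDokchitser2015LocalInvariants, §3 Cor. 8] [cite: Stevens1989, §2] -/
theorem optimalUnstarredAcrossIsogeny_of_mod_twelve_eq_one {p : ℕ} (hp12 : p % 12 = 1) :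
    OptimalUnstarredAcrossIsogeny p := by
  intro W W₂ _ _ _ _ _ D φ hp _ _ hpN hdeg hv₂
  haveI : Fact p.Prime := ⟨hp⟩
  have hadd : Addv W p := not_good_and_not_mult_of_sq_dvd_conductorNorm W hpN
  rw [padicValInt_minimalDiscriminantInt_eq_of_degree_prime_of_mod_twelve hp12 W W₂ φ hdeg hadd hv₂]
  exact hv₂

end Summit.BirchSwinnertonDyer.BirchSwinnertonDyer.Theorems

end
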